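import Summits.Langlands.Langlands.Theses.SkinnerWilesDefectOne
import Literature.NumberTheory.Automorphic.OrdinaryCompletedCohomologyGL
import Literature.NumberTheory.GaloisRepresentations.HeckeCharacter
import Summits.Langlands.Langlands.Theorems.SkinnerWilesDefectOneProModularOrdinaryClassicalGivenBianchiFiniteness
set_option linter.dupNamespace false

noncomputable section

/-!
# Birth skeleton (BC3) of the split child `CmInducedClassical` (X₂, support) of `ProModularOrdinaryClassical`
# (stmt-Langlands-12921), route SkinnerWilesDefectOne

`X₂` is a theorem in print; its line is the landed CM branch of `top-degree-exact-control`.  Stubs = the two printed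
named facts it still consumes (each an XL formalisation: Arthur–Clozel Ch. 3 Thm. 6.2 / Lemma 6.4; Henniart 2012), and
`CmInducedClassical_of` is the LANDED certificate (`cmInducedCuspidal_of_two_facts` p112953 ∘ `stub_cmSatakeFrobGlue`
p106683).  `X₂` is stated unfolded (this file predates the route edit).
-/

namespace Summit.Langlands.Langlands.Cruxes.CmInducedClassical.Birth

open Summit.Langlands.Langlands.Theses.SkinnerWilesDefectOne
open Summit.Langlands.Langlands.Cruxes.ProModularOrdinaryClassical.TopDegreeExactControl
open Summit.Langlands.Langlands.Theorems.SkinnerWilesDefectOne.GivenBianchiFiniteness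
open Literature.NumberTheory.Automorphic Literature.NumberTheory.GaloisRepresentations
open NumberField IsDedekindDomain Filter Polynomial
open scoped Classical

/-- **Stub 1 — cuspidal cyclic automorphic induction** (Arthur–Clozel Ch. 3 Thm. 6.2 / Lemma 6.4; named fact, XL). -/
theorem stub_automorphicInduction_cyclic_cuspidal :
    Literature.NumberTheory.Automorphic.automorphicInduction_cyclic_cuspidal := by
  sorry

/-- **Stub 2 — Henniart's infinity type of an automorphic induction** (Henniart 2012 Thm. 3 (i); named fact, XL). -/
theorem stub_henniartInfinityType :
    Literature.NumberTheory.Automorphic.Henniart2012_infinityType_of_automorphicInduction := by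
  sorry

/-- **The child from its two stubs** — the landed CM branch. [folklore] -/
theorem CmInducedClassical_of :
    Literature.NumberTheory.Automorphic.automorphicInduction_cyclic_cuspidal →
    Literature.NumberTheory.Automorphic.Henniart2012_infinityType_of_automorphicInduction →
    (∀ (F : Type) [Field F] [NumberField F] (p : ℕ) [Fact p.Prime] (hcpt : Literature.NumberTheory.Automorphic.isCompact_glFiniteIntegralLevel 2 F) (ι : PadicAlgCl p ≃+* ℂ) (ρ : Literature.NumberTheory.GaloisRepresentations.FramedGaloisRep F (PadicAlgCl p) 2), (∃ (K : Type) (_ : Field K) (_ : NumberField K) (_ : Algebra F K) (_ : Module.finrank F K = 2) (θ : Literature.NumberTheory.GaloisRepresentations.HeckeCharacter K), θ.IsAlgebraic ∧ (∃ᶠ w : IsDedekindDomain.HeightOneSpectrum (NumberField.RingOfIntegers K) in Filter.cofinite, ∃ w' : IsDedekindDomain.HeightOneSpectrum (NumberField.RingOfIntegers K), w'.asIdeal.under (NumberField.RingOfIntegers F) = w.asIdeal.under (NumberField.RingOfIntegers F) ∧ θ.valueAtUniformizer w' ≠ θ.valueAtUniformizer w) ∧ ∀ᶠ v : IsDedekindDomain.HeightOneSpectrum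 (NumberField.RingOfIntegers F) in Filter.cofinite, ρ.IsUnramifiedAt v ∧ ρ.HasFrobCharpolyAt v (∏ᶠ w ∈ {w : IsDedekindDomain.HeightOneSpectrum (NumberField.RingOfIntegers K) | w.under (NumberField.RingOfIntegers F) = v}, (Polynomial.X ^ w.asIdeal.inertiaDeg (NumberField.RingOfIntegers F) - Polynomial.C (ι.symm (θ.valueAtUniformizer w)⁻¹)))) → ∃ π : Literature.NumberTheory.Automorphic.CuspidalAutomorphicRepData 2 F hcpt, π.1.IsLAlgebraic ∧ ∀ᶠ v in Filter.cofinite, Summit.Langlands.SatakeFrobCompatibleAt ι π.1 ρ v) := by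
  intro hAI hHen F _ _ p _ hcpt ι ρ hcm
  obtain ⟨K, iK, iN, iA, hK, θ, halg, hreg, hfrob⟩ := hcm
  obtain ⟨π, hLalg, hsat⟩ := @cmInducedCuspidal_of_two_facts hAI hHen F _ _ hcpt K iK iN iA hK θ halg hreg
  exact ⟨π, hLalg, @stub_cmSatakeFrobGlue F _ _ p _ hcpt ι ρ K iK iN iA hK θ π hsat hfrob⟩

/-- Sanity: the composition applied to the stubs concludes the child. [folklore] -/
theorem CmInducedClassical_birth :
    ∀ (F : Type) [Field F] [NumberField F] (p : ℕ) [Fact p.Prime] (hcpt : Literature.NumberTheory.Automorphic.isCompact_glFiniteIntegralLevel 2 F) (ι : PadicAlgCl p ≃+* ℂ) (ρ : Literature.NumberTheory.GaloisRepresentations.FramedGaloisRep F (PadicAlgCl p) 2), (∃ (K : Type) (_ : Field K) (_ : NumberField K) (_ : Algebra F K) (_ : Module.finrank F K = 2) (θ : Literature.NumberTheory.GaloisRepresentations.HeckeCharacter K), θ.IsAlgebraic ∧ (∃ᶠ w : IsDedekindDomain.HeightOneSpectrum (NumberField.RingOfIntegers K) in Filter.cofinite, ∃ w' : IsDedekindDomain.HeightOneSpectrum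 (NumberField.RingOfIntegers K), w'.asIdeal.under (NumberField.RingOfIntegers F) = w.asIdeal.under (NumberField.RingOfIntegers F) ∧ θ.valueAtUniformizer w' ≠ θ.valueAtUniformizer w) ∧ ∀ᶠ v : IsDedekindDomain.HeightOneSpectrum (NumberField.RingOfIntegers F) in Filter.cofinite, ρ.IsUnramifiedAt v ∧ ρ.HasFrobCharpolyAt v (∏ᶠ w ∈ {w : IsDedekindDomain.HeightOneSpectrum (NumberField.RingOfIntegers K) | w.under (NumberField.RingOfIntegers F) = v}, (Polynomial.X ^ w.asIdeal.inertiaDeg (NumberField.RingOfIntegers F) - Polynomial.C (ι.symm (θ.valueAtUniformizer w)⁻¹)))) → ∃ π : Literature.NumberTheory.Automorphic.CuspidalAutomorphicRepData 2 F hcpt, π.1.IsLAlgebraic ∧ ∀ᶠ v in Filter.cofinite, Summit.Langlands.SatakeFrobCompatibleAt ι π.1 ρ v :=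
  CmInducedClassical_of stub_automorphicInduction_cyclic_cuspidal stub_henniartInfinityType

end Summit.Langlands.Langlands.Cruxes.CmInducedClassical.Birth

end
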